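/-
Copyright (c) 2026 the pub-hodgecm-mathlib formalisation cell (harness21).  Prover seat hodgecm-mathlib-K2Liu-p01 (g6), Track B «K2-LIT»,
Road I organ (A-int)-fin, A2d-2 «geometric actions junction — the master formula in the adapted blocks» (LEAD F0P6-plan (g12) 08:00:40Z).
KERNEL: theorems only.
-/
import Summits.HodgeConjecture.HodgeConjecture.Theorems.K2LiuDeltaSpTransportSiegelLetters   -- ★ A2d-1 p858555 (§1 Sp-decomposition, §2 `ℓ_Δ` vs `deltaCoords`, §3 letters)
import HarnessLib

/-!
# Crux `HLiu418`, Track B road `K2_Liu`, Road I organ (A-int)-fin — A2d-2: THE MASTER FORMULA — `deltaCoords ∘ ι(h) ∘ deltaCoords⁻¹` IN THE ADAPTED BLOCKS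
# `σ′ (R b, R a) = (R (C a + D b), R (A a + B b))`, and the EXPLICIT LEVI LETTER `σ′ = m(R D R⁻¹, R A R⁻¹)` for `B = C = 0`

Cell `hodgecm-mathlib`, crux item hLiu418 = `stmt-HodgeConjecture-24832`, route of record `HCCMUnconditional`; squad K2 ∕ K2Liu, prover K2Liu-p01 (g6).
THEOREMS ONLY (no `def`, no instance, no notation, no named fact, no `sorry`); lane `--supports stmt-HodgeConjecture-24832 --as helper`.

The GR91 frame ★ `eD : (E⊗F_v)^{Δ ⊕ Δ⁻-indices} ≃ 𝕎_v` (`eD (matA g · u) = ι(g)(eD u)`, ★ `eD_matA_mulVec`) and the ★ adapted blocks `adapt (matA g) = (A, B; C, D)`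
(`M (dblV a + adblV b) = dblV (A a + B b) + adblV (C a + D b)`, ★ `mulVec_dblV_add_adblV`) are read through ★ `deltaCoords`: with the REAL FRAME
`R c := glue e₂ (re ∘ c) (im ∘ c) : (Fin n → E⊗F_v) → (Fin (n+n) → F_v)` (written out, no def),
* §1 `eD_dblV`, `eD_adblV`, **`deltaCoords_eD_dblV_add_adblV : deltaCoords (eD (dblV a + adblV b)) = (R b, R a)`** (`X_Δ ↔ Δ⁻ = ℓ_∇`, `Y_Δ ↔ Δ = ℓ_Δ`), `glue_re_im_surjective`;
* §2 **THE MASTER FORMULA `deltaTransport_iotaD_apply : σ′ (R b, R a) = (R (C a + D b), R (A a + B b))`** for EVERY `h ∈ U(𝔻)(F_v)`;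
* §3 **THE LEVI LETTER `exists_deltaTransport_iotaD_eq_leviSp`**: `B = C = 0` (★ `K2LiuSiegelLeviWeylAlgebra` ∕ B1b-1 `adapt_matA_weylDelta_mul_frameConj_weylSiegel` currency) ⇒
  `σ′ = leviSp a d` with `a (R b) = R (D b)`, `d (R a′) = R (A a′)` — the explicit Levi letter A2a's `krFun_leviOp` consumes (the `1 ⊗ g` letter of `U(V′_w)` and the
  `M_Δ` letter are its instances; the Weyl letter via ★ `iotaD_weylDelta_eq_transportSp_levi` is A2d-3).

HONEST LABEL: HC_CM is proved only modulo the printed citations (2 remaining named inputs: hLiu418 = stmt-HodgeConjecture-24832, h413 = stmt-HodgeConjecture-24833)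
until rung 0 closes; helper, closes no item.
References: [Kudla1994] §2–§3; [HarrisKudlaSweet1996] §1 (1.11); [Weil1964] n° 6; [MoeglinVignerasWaldspurger1987] Chap. 2 I.7, II.6.
-/

set_option autoImplicit false
set_option linter.dupNamespace false -- the mandated namespace repeats `HodgeConjecture.HodgeConjecture`

noncomputable section

open Matrix Topology
open NumberField IsDedekindDomain
open Literature.NumberTheory.Automorphic Literature.NumberTheory.Automorphic.UnitaryGroup
open Literature.NumberTheory.Automorphic.UnitaryGroup.QuadraticCoordinates
open Literature.RepresentationTheory.HeisenbergGroup
open Literature.NumberTheory.GelbartRogawski1991 Literature.NumberTheory.GelbartRogawski1991.AdaptedBlocks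
open Literature.NumberTheory.GelbartRogawski1991.UnitaryDualPair.LocalSplitting
open Summit.HodgeConjecture.HodgeConjecture.Cruxes.HLiu418.K2LiuDeltaSpTransportSiegelLetters

namespace Summit.HodgeConjecture.HodgeConjecture.Cruxes.HLiu418.K2LiuDeltaSpTransportAdaptedBlocks

variable (F : Type) [Field F] [NumberField F] (E : Type) [Field E] [NumberField E] [Algebra F E]
  [Algebra.IsQuadraticExtension F E] (c : E ≃ₐ[F] E)
  {δ : E} (hcδ : c δ = -δ) (hδ : δ ≠ 0) {d : F} (hd : δ * δ = algebraMap F E d)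
  (v : HeightOneSpectrum (𝓞 F)) (n : ℕ) {T₀ : Matrix (Fin n) (Fin n) F} (hT₀ : T₀.IsSymm) (hT₀d : IsUnit T₀.det)
  {JD : Matrix (Fin (n + n)) (Fin (n + n)) E} (hJD : JD = (gramD F n T₀).map (algebraMap F E))

/-! ## §1 The frame `eD` through `deltaCoords`: `Δ ↦ Y_Δ`, `Δ⁻ ↦ X_Δ`, both read by the real frame `R` -/

/-- `eD (dblV a) = deltaW (re ∘ a) (im ∘ a)` — the diagonal vectors go to the `deltaW`'s. [cite: HarrisKudlaSweet1996, §1 (1.11)] -/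
theorem eD_dblV (a : Fin n → LocalRing E v) :
    eD F E c hcδ hδ hd v n (dblV a) =
      deltaW (e₂ n) (fun i => re (quadraticLocalEquiv E v c hcδ hδ).toLinearEquiv.toAddEquiv (a i))
        (fun i => im (quadraticLocalEquiv E v c hcδ hδ).toLinearEquiv.toAddEquiv (a i)) := by
  rw [eD_apply]
  refine Prod.ext (funext fun k => ?_) (funext fun k => ?_)
  · show re _ ((dblV a ∘ (e₂ n).symm) k) = glue (e₂ n) _ _ k
    simp only [Function.comp_apply, dblV, glue]
    cases (e₂ n).symm k <;> rfl
  · show im _ ((dblV a ∘ (e₂ n).symm) k) = glue (e₂ n) _ _ k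
    simp only [Function.comp_apply, dblV, glue]
    cases (e₂ n).symm k <;> rfl

/-- `eD (adblV b) = nablaW (re ∘ b) (im ∘ b)` — the antidiagonal vectors go to the `nablaW`'s. [cite: HarrisKudlaSweet1996, §1 (1.11)] -/
theorem eD_adblV (b : Fin n → LocalRing E v) :
    eD F E c hcδ hδ hd v n (adblV b) =
      nablaW (e₂ n) (fun i => re (quadraticLocalEquiv E v c hcδ hδ).toLinearEquiv.toAddEquiv (b i))
        (fun i => im (quadraticLocalEquiv E v c hcδ hδ).toLinearEquiv.toAddEquiv (b i)) := by
  rw [eD_apply]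
  refine Prod.ext (funext fun k => ?_) (funext fun k => ?_)
  · show re _ ((adblV b ∘ (e₂ n).symm) k) = glue (e₂ n) _ _ k
    simp only [Function.comp_apply, adblV, glue]
    cases (e₂ n).symm k with
    | inl i => rfl
    | inr i => simp only [Sum.elim_inr, Pi.neg_apply, map_neg]
  · show im _ ((adblV b ∘ (e₂ n).symm) k) = glue (e₂ n) _ _ k
    simp only [Function.comp_apply, adblV, glue]
    cases (e₂ n).symm k with
    | inl i => rfl
    | inr i => simp only [Sum.elim_inr, Pi.neg_apply, map_neg]

/-- **`deltaCoords (eD (dblV a + adblV b)) = (R b, R a)`** with the real frame `R c = glue e₂ (re ∘ c) (im ∘ c)`: the `Δ⁻`-component is the `X_Δ`-coordinate, the `Δ`-component the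
`Y_Δ`-coordinate. [cite: Kudla1994, §2] [cite: HarrisKudlaSweet1996, §1 (1.11)] -/
theorem deltaCoords_eD_dblV_add_adblV (a b : Fin n → LocalRing E v) :
    deltaCoords (K := v.adicCompletion F) (e₂ n) (eD F E c hcδ hδ hd v n (dblV a + adblV b)) =
      (glue (e₂ n) (fun i => re (quadraticLocalEquiv E v c hcδ hδ).toLinearEquiv.toAddEquiv (b i))
          (fun i => im (quadraticLocalEquiv E v c hcδ hδ).toLinearEquiv.toAddEquiv (b i)),
        glue (e₂ n) (fun i => re (quadraticLocalEquiv E v c hcδ hδ).toLinearEquiv.toAddEquiv (a i))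
          (fun i => im (quadraticLocalEquiv E v c hcδ hδ).toLinearEquiv.toAddEquiv (a i))) := by
  rw [map_add, map_add, eD_dblV, eD_adblV, deltaCoords_deltaW, deltaCoords_nablaW, Prod.mk_add_mk, zero_add, add_zero]

/-- **every vector of `F_v^{n+n}` is `R c`** for `c i := Ψ (x_L i, x_R i)`: the real frame is onto. [folklore] -/
theorem exists_eq_glue_re_im (x : Fin (n + n) → v.adicCompletion F) :
    ∃ cc : Fin n → LocalRing E v,
      glue (e₂ n) (fun i => re (quadraticLocalEquiv E v c hcδ hδ).toLinearEquiv.toAddEquiv (cc i))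
        (fun i => im (quadraticLocalEquiv E v c hcδ hδ).toLinearEquiv.toAddEquiv (cc i)) = x := by
  refine ⟨fun i => (quadraticLocalEquiv E v c hcδ hδ).toLinearEquiv.toAddEquiv (resL (e₂ n) x i, resR (e₂ n) x i), ?_⟩
  simp only [re_apply, im_apply]
  exact glue_resL_resR (e₂ n) x

/-! ## §2 The master formula -/

include hT₀ hJD in
/-- **THE MASTER FORMULA**: for every `h ∈ U(𝔻)(F_v)` with adapted blocks `(A, B; C, D) = adapt (matA h)`,
`(deltaCoords ∘ ι(h) ∘ deltaCoords⁻¹) (R b, R a) = (R (C a + D b), R (A a + B b))` — `X_Δ` carries the `Δ⁻`-components, `Y_Δ` the `Δ`-components.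
[cite: Kudla1994, §3] [cite: MoeglinVignerasWaldspurger1987, Chap. 2 I.7] -/
theorem deltaTransport_iotaD_apply (h : UnitaryGroup.localPi E c (n + n) JD v) (a b : Fin n → LocalRing E v) :
    ((deltaSymplecticTransport (e₂ n) (T₀.map (algebraMap F (v.adicCompletion F))) (localGram_gramD F v n (T₀ := T₀))
        (iotaD F E c hcδ hδ hd v n hT₀ hJD h) :
        symplecticGroup (polar (Matrix.toLinearMap₂' (v.adicCompletion F) (deltaGram (e₂ n) (T₀.map (algebraMap F (v.adicCompletion F))))))) :
        ((Fin (n + n) → v.adicCompletion F) × (Fin (n + n) → v.adicCompletion F)) ≃ₗ[v.adicCompletion F]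
          ((Fin (n + n) → v.adicCompletion F) × (Fin (n + n) → v.adicCompletion F)))
      (glue (e₂ n) (fun i => re (quadraticLocalEquiv E v c hcδ hδ).toLinearEquiv.toAddEquiv (b i))
          (fun i => im (quadraticLocalEquiv E v c hcδ hδ).toLinearEquiv.toAddEquiv (b i)),
        glue (e₂ n) (fun i => re (quadraticLocalEquiv E v c hcδ hδ).toLinearEquiv.toAddEquiv (a i))
          (fun i => im (quadraticLocalEquiv E v c hcδ hδ).toLinearEquiv.toAddEquiv (a i))) =
      (glue (e₂ n) (fun i => re (quadraticLocalEquiv E v c hcδ hδ).toLinearEquiv.toAddEquiv ((blkC (matA F E c v n h) *ᵥ a + blkD (matA F E c v n h) *ᵥ b) i))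
          (fun i => im (quadraticLocalEquiv E v c hcδ hδ).toLinearEquiv.toAddEquiv ((blkC (matA F E c v n h) *ᵥ a + blkD (matA F E c v n h) *ᵥ b) i)),
        glue (e₂ n) (fun i => re (quadraticLocalEquiv E v c hcδ hδ).toLinearEquiv.toAddEquiv ((blkA (matA F E c v n h) *ᵥ a + blkB (matA F E c v n h) *ᵥ b) i))
          (fun i => im (quadraticLocalEquiv E v c hcδ hδ).toLinearEquiv.toAddEquiv ((blkA (matA F E c v n h) *ᵥ a + blkB (matA F E c v n h) *ᵥ b) i))) := by
  rw [deltaSymplecticTransport_apply, ← deltaCoords_eD_dblV_add_adblV F E c hcδ hδ hd v n a b, LinearEquiv.symm_apply_apply,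
    show (iotaD F E c hcδ hδ hd v n hT₀ hJD h).1 (eD F E c hcδ hδ hd v n (dblV a + adblV b)) =
      toLin F v (iotaD F E c hcδ hδ hd v n hT₀ hJD h) (eD F E c hcδ hδ hd v n (dblV a + adblV b)) from rfl,
    ← eD_matA_mulVec F E c hcδ hδ hd v n hT₀ hJD, mulVec_dblV_add_adblV, deltaCoords_eD_dblV_add_adblV]

/-! ## §3 The Levi letter, explicitly -/

include hT₀ hT₀d hJD in
/-- **THE LEVI LETTER**: if the adapted blocks of `h` are block-DIAGONAL (`B = C = 0`: `h` stabilises `ℓ_Δ` AND `ℓ_∇`; e.g. `1 ⊗ g`, `g ∈ U(V′_w)`, or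
`weylDelta · frameConj Q weylSiegel` of ★ B1b-1), then `deltaCoords ∘ ι(h) ∘ deltaCoords⁻¹ = leviSp a d` with `a (R b) = R (D b)` and `d (R a′) = R (A a′)` — the EXPLICIT
Levi operator `f ↦ f ∘ a⁻¹` (★ `leviOp`) that A2a's `krFun_leviOp` consumes, up to the splitting scalar (★ A2c ∕ A2d-1 junction).
[cite: Weil1964, n° 6, n° 13] [cite: Kudla1994, §3] -/
theorem exists_deltaTransport_iotaD_eq_leviSp (h : UnitaryGroup.localPi E c (n + n) JD v)
    (hB : blkB (matA F E c v n h) = 0) (hC : blkC (matA F E c v n h) = 0) :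
    ∃ (a d : (Fin (n + n) → v.adicCompletion F) ≃ₗ[v.adicCompletion F] (Fin (n + n) → v.adicCompletion F))
      (had : ∀ x y : Fin (n + n) → v.adicCompletion F,
        Matrix.toLinearMap₂' (v.adicCompletion F) (deltaGram (e₂ n) (T₀.map (algebraMap F (v.adicCompletion F)))) (a x) (d y) =
          Matrix.toLinearMap₂' (v.adicCompletion F) (deltaGram (e₂ n) (T₀.map (algebraMap F (v.adicCompletion F)))) x y),
      deltaSymplecticTransport (e₂ n) (T₀.map (algebraMap F (v.adicCompletion F))) (localGram_gramD F v n (T₀ := T₀))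
          (iotaD F E c hcδ hδ hd v n hT₀ hJD h) = leviSp _ a d had ∧
        (∀ b : Fin n → LocalRing E v,
          a (glue (e₂ n) (fun i => re (quadraticLocalEquiv E v c hcδ hδ).toLinearEquiv.toAddEquiv (b i))
              (fun i => im (quadraticLocalEquiv E v c hcδ hδ).toLinearEquiv.toAddEquiv (b i))) =
            glue (e₂ n) (fun i => re (quadraticLocalEquiv E v c hcδ hδ).toLinearEquiv.toAddEquiv ((blkD (matA F E c v n h) *ᵥ b) i))
              (fun i => im (quadraticLocalEquiv E v c hcδ hδ).toLinearEquiv.toAddEquiv ((blkD (matA F E c v n h) *ᵥ b) i))) ∧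
        (∀ a' : Fin n → LocalRing E v,
          d (glue (e₂ n) (fun i => re (quadraticLocalEquiv E v c hcδ hδ).toLinearEquiv.toAddEquiv (a' i))
              (fun i => im (quadraticLocalEquiv E v c hcδ hδ).toLinearEquiv.toAddEquiv (a' i))) =
            glue (e₂ n) (fun i => re (quadraticLocalEquiv E v c hcδ hδ).toLinearEquiv.toAddEquiv ((blkA (matA F E c v n h) *ᵥ a') i))
              (fun i => im (quadraticLocalEquiv E v c hcδ hδ).toLinearEquiv.toAddEquiv ((blkA (matA F E c v n h) *ᵥ a') i))) := by
  set σ' := deltaSymplecticTransport (e₂ n) (T₀.map (algebraMap F (v.adicCompletion F))) (localGram_gramD F v n (T₀ := T₀))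
    (iotaD F E c hcδ hδ hd v n hT₀ hJD h) with hσ'
  have hg0 : glue (e₂ n) (fun _ : Fin n => (0 : v.adicCompletion F)) (fun _ : Fin n => (0 : v.adicCompletion F)) = 0 := glue_zero (e₂ n)
  -- the master formula with `B = C = 0`
  have hM : ∀ a b : Fin n → LocalRing E v,
      (σ' : ((Fin (n + n) → v.adicCompletion F) × (Fin (n + n) → v.adicCompletion F)) ≃ₗ[v.adicCompletion F]
          ((Fin (n + n) → v.adicCompletion F) × (Fin (n + n) → v.adicCompletion F)))
        (glue (e₂ n) (fun i => re (quadraticLocalEquiv E v c hcδ hδ).toLinearEquiv.toAddEquiv (b i))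
            (fun i => im (quadraticLocalEquiv E v c hcδ hδ).toLinearEquiv.toAddEquiv (b i)),
          glue (e₂ n) (fun i => re (quadraticLocalEquiv E v c hcδ hδ).toLinearEquiv.toAddEquiv (a i))
            (fun i => im (quadraticLocalEquiv E v c hcδ hδ).toLinearEquiv.toAddEquiv (a i))) =
        (glue (e₂ n) (fun i => re (quadraticLocalEquiv E v c hcδ hδ).toLinearEquiv.toAddEquiv ((blkD (matA F E c v n h) *ᵥ b) i))
            (fun i => im (quadraticLocalEquiv E v c hcδ hδ).toLinearEquiv.toAddEquiv ((blkD (matA F E c v n h) *ᵥ b) i)),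
          glue (e₂ n) (fun i => re (quadraticLocalEquiv E v c hcδ hδ).toLinearEquiv.toAddEquiv ((blkA (matA F E c v n h) *ᵥ a) i))
            (fun i => im (quadraticLocalEquiv E v c hcδ hδ).toLinearEquiv.toAddEquiv ((blkA (matA F E c v n h) *ᵥ a) i))) := by
    intro a b
    have hm := deltaTransport_iotaD_apply F E c hcδ hδ hd v n hT₀ hJD h a b
    rw [hB, hC, Matrix.zero_mulVec, Matrix.zero_mulVec, zero_add, add_zero] at hm
    exact hm
  -- `σ′` preserves `0 × Y` and `X × 0`
  have h0 : ∀ y : Fin (n + n) → v.adicCompletion F,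
      ((σ' : ((Fin (n + n) → v.adicCompletion F) × (Fin (n + n) → v.adicCompletion F)) ≃ₗ[v.adicCompletion F]
          ((Fin (n + n) → v.adicCompletion F) × (Fin (n + n) → v.adicCompletion F))) (0, y)).1 = 0 := by
    intro y
    obtain ⟨aa, rfl⟩ := exists_eq_glue_re_im F E c hcδ hδ v n y
    have h1 := hM aa 0
    simp only [map_zero, Matrix.mulVec_zero, Pi.zero_apply, hg0] at h1
    rw [h1]
  have h1 : ∀ x : Fin (n + n) → v.adicCompletion F,
      ((σ' : ((Fin (n + n) → v.adicCompletion F) × (Fin (n + n) → v.adicCompletion F)) ≃ₗ[v.adicCompletion F]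
          ((Fin (n + n) → v.adicCompletion F) × (Fin (n + n) → v.adicCompletion F))) (x, 0)).2 = 0 := by
    intro x
    obtain ⟨bb, rfl⟩ := exists_eq_glue_re_im F E c hcδ hδ v n x
    have h2 := hM 0 bb
    simp only [map_zero, Matrix.mulVec_zero, Pi.zero_apply, hg0] at h2
    rw [h2]
  obtain ⟨a, d', had, heq, ha, hd'⟩ := exists_eq_leviSp (deltaGram (e₂ n) (T₀.map (algebraMap F (v.adicCompletion F))))
    (isUnit_det_deltaGram (e₂ n) _ (isUnit_det_map_local F v n hT₀d)) σ' h0 h1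
  refine ⟨a, d', had, heq, fun b => ?_, fun a' => ?_⟩
  · have h2 := hM 0 b
    simp only [map_zero, Matrix.mulVec_zero, Pi.zero_apply, hg0] at h2
    rw [← ha, h2]
  · have h2 := hM a' 0
    simp only [map_zero, Matrix.mulVec_zero, Pi.zero_apply, hg0] at h2
    rw [← hd', h2]

end Summit.HodgeConjecture.HodgeConjecture.Cruxes.HLiu418.K2LiuDeltaSpTransportAdaptedBlocks

end
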